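import Mathlib
import HarnessLib
import Literature.MathematicalPhysics.StatisticalMechanics.InitialActivityPerturbationBundled
import Literature.MathematicalPhysics.StatisticalMechanics.InitialActivityJointSecondDiffBilinear
import Literature.MathematicalPhysics.StatisticalMechanics.InitialActivityHamiltonianBundled

/-!
# Crux `HypALocalTwoPoint`, line `gnv` — the four initial activities `K̂_0(𝒦 + iU + jV, ·)` in the
# interface of the abstract free-energy assembly

Route `route-HubbardSuperconductivity-ComplexGFFStiffness`, crux item stmt-HubbardSuperconductivity-19155,
registered stub `stub_twoPointGivenZ` (⇐ `FreeEnergyBounds`), census F1 (iii-b).  The abstract assembly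
`RGFlow.freeEnergySizes_of_isTunedQ` wants four initial-activity maps `y₀ i j : E_0 → F_0`
(`i, j ∈ Bool`) that are `m₀`-Lipschitz in the seed (`hm`), have first differences `μ₁` in `i` (`hμ1`)
and `μ₂` in `j` (`hμ2`), and joint parallelogram second differences `m₀₀(u₁+‖y‖)(u₂+‖z‖)` (`hμ12`).  For
`y₀ i j = initAct (Kf i j)` with `Kf ∈ {𝒦, 𝒦+U, 𝒦+V, 𝒦+U+V}` these are [ABKM19] Lemma 12.2 and its
second-order versions, all in the tree (`activityNormLE_initAct_sub`, `activityNormLE_initAct_sub_pert`,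
`activityNormLE_initAct_jointSecondDiff_bilinear`); this file only packages them in the `Bool × Bool`
indexing with explicit, volume-independent constants:

* **`initActFamily_bounds`** — `hm ∧ hμ1 ∧ hμ2 ∧ hμ12` for the family `Kf`.

All proved, no `sorry`.

## References
* S. Adams, S. Buchholz, R. Kotecký, S. Müller, arXiv:1910.13564, Lemma 12.2, Lemma 12.6
  [AdamsBuchholzKoteckyMuller2019].
-/

noncomputable section

-- `Summit.<Summit>.<Problem>`: single-conjunct summit, the duplicate component is mandated (D-0017).
set_option linter.dupNamespace false

namespace Summit.HubbardSuperconductivity.HubbardSuperconductivity.Theorems.ComplexGFF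

open scoped BigOperators
open Real Set Finset MeasureTheory
open Literature.MathematicalPhysics.StatisticalMechanics.GradientRG

variable {d M : ℕ} [NeZero M]

section Package

variable {L N Mord R n pT r₀ : ℕ} {θbar lam μ δ₁ δ₀ A𝒫 h A : ℝ}
    {𝒞 : Matrix (Fin d) (Fin d) ℝ → ℕ → (Fin d → ZMod M) → ℝ}

set_option maxHeartbeats 1600000 in
/-- **The four initial activities in the interface of the abstract assembly** (module docstring):
Lipschitz in the seed with `m₀ = 16e^{3/8}ρ𝒦e^{𝔥₀}A`, first differences
`μ_i = e^{1/4}e^{𝔥₀}A·u_i`, joint second differences `m₀₀(u₁+‖y‖)(u₂+‖z‖)` with the explicit `m₀₀` of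
`activityNormLE_initAct_jointSecondDiff_bilinear`, on the `ρ`-ball, `ρ ≤ 1/64`.
([ABKM19] Lemma 12.2 and its second-order versions.) -/
theorem initActFamily_bounds
    [∀ j : ℕ, Fact (0 < fieldWt h (L : ℝ) d j)] [∀ j : ℕ, Fact (0 < (L : ℝ) ^ j)] [∀ j : ℕ, Fact (0 < L ^ (d * j))]
    (hd2 : 2 ≤ d) (hLodd : Odd L) (hM : M = L ^ N)
    (hp : d / 2 + 1 ≤ pT) (hMord : d / 2 + 1 ≤ Mord)
    (hB : AbkmWeightBounds L N Mord R n θbar lam μ δ₁ δ₀ A𝒫 (fun j => 𝒞 1 j)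
      (abkmWeightData L N Mord R θbar (schedDelta δ₀ δ₁ N) fun j => 𝒞 1 j))
    (hδ₀ : 0 < δ₀) (hδ₁ : 0 < δ₁) (hh : 0 < h) (hh0 : hZeroSq d R δ₀ δ₁ ≤ h ^ 2) (hA : 0 < A)
    {ρ : ℝ} (hρ64 : ρ ≤ 1 / 64)
    -- the perturbation and its two increments
    {𝒦 U V : (Fin d → ℝ) → ℂ} {ρ𝒦 u₁ u₂ : ℝ} (h𝒦 : ContDiff ℝ r₀ 𝒦) (hU : ContDiff ℝ r₀ U) (hV : ContDiff ℝ r₀ V)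
    (h𝒦b : ∀ s, s ≤ r₀ → ∀ z : Fin d → ℝ, ‖iteratedFDeriv ℝ s 𝒦 z‖ ≤ ρ𝒦 * Real.exp ((∑ i, z i ^ 2) / 4))
    (h𝒦Ub : ∀ s, s ≤ r₀ → ∀ z : Fin d → ℝ,
      ‖iteratedFDeriv ℝ s (fun z => 𝒦 z + U z) z‖ ≤ ρ𝒦 * Real.exp ((∑ i, z i ^ 2) / 4))
    (h𝒦Vb : ∀ s, s ≤ r₀ → ∀ z : Fin d → ℝ,
      ‖iteratedFDeriv ℝ s (fun z => 𝒦 z + V z) z‖ ≤ ρ𝒦 * Real.exp ((∑ i, z i ^ 2) / 4))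
    (h𝒦UVb : ∀ s, s ≤ r₀ → ∀ z : Fin d → ℝ,
      ‖iteratedFDeriv ℝ s (fun z => 𝒦 z + U z + V z) z‖ ≤ ρ𝒦 * Real.exp ((∑ i, z i ^ 2) / 4))
    (hUb : ∀ s, s ≤ r₀ → ∀ z : Fin d → ℝ, ‖iteratedFDeriv ℝ s U z‖ ≤ u₁ * Real.exp ((∑ i, z i ^ 2) / 4))
    (hVb : ∀ s, s ≤ r₀ → ∀ z : Fin d → ℝ, ‖iteratedFDeriv ℝ s V z‖ ≤ u₂ * Real.exp ((∑ i, z i ^ 2) / 4))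
    (hu₁ : 0 ≤ u₁) (hu₂ : 0 ≤ u₂)
    (h𝒦small : (Real.exp (1 / 4) + 2 * Real.exp (3 / 8)) * (ρ𝒦 * Real.exp (fieldWt h (L : ℝ) d 0 / (L : ℝ) ^ 0)) * A ≤ 1 / 2)
    (hpert : (Real.exp (1 / 4) + 16 * Real.exp (3 / 8) * (2 * ρ) + 16 * Real.exp (3 / 8) * (2 * ρ)
        + 256 * Real.exp (1 / 4) * (2 * ρ) * (2 * ρ)) * ((ρ𝒦 + u₁ + u₂) * Real.exp (fieldWt h (L : ℝ) d 0 / (L : ℝ) ^ 0)) * A ≤ 1 / 2)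
    (Kf : Bool → Bool → (Fin d → ℝ) → ℂ) (hKtt : Kf true true = fun w => 𝒦 w + U w + V w)
    (hKtf : Kf true false = fun w => 𝒦 w + U w) (hKft : Kf false true = fun w => 𝒦 w + V w)
    (hKff : Kf false false = 𝒦) :
    (∀ i j, ∀ h₀ h₀' : HamSpace ℂ d (fieldWt h (L : ℝ) d 0) ((L : ℝ) ^ 0) (L ^ (d * 0)), ‖h₀‖ ≤ ρ → ‖h₀'‖ ≤ ρ →
      activityNormLE (abkmNormParams L N Mord R pT r₀ h θbar A (schedDelta δ₀ δ₁ N) fun j => 𝒞 1 j) 0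
        ((initAct (N := N) (Mord := Mord) (R := R) (p := pT) (r₀ := r₀) (θbar := θbar) (A := A) (δ₀ := δ₀)
            (δ₁ := δ₁) (𝒞 := fun j => 𝒞 1 j) (Kf i j) h₀) - (initAct (N := N) (Mord := Mord) (R := R) (p := pT) (r₀ := r₀) (θbar := θbar) (A := A) (δ₀ := δ₀)
            (δ₁ := δ₁) (𝒞 := fun j => 𝒞 1 j) (Kf i j) h₀')) ((16 * Real.exp (3 / 8) * (ρ𝒦 * Real.exp (fieldWt h (L : ℝ) d 0 / (L : ℝ) ^ 0)) * A) * ‖h₀ - h₀'‖)) ∧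
    (∀ j, ∀ h₀ : HamSpace ℂ d (fieldWt h (L : ℝ) d 0) ((L : ℝ) ^ 0) (L ^ (d * 0)), ‖h₀‖ ≤ ρ →
      activityNormLE (abkmNormParams L N Mord R pT r₀ h θbar A (schedDelta δ₀ δ₁ N) fun j => 𝒞 1 j) 0
        ((initAct (N := N) (Mord := Mord) (R := R) (p := pT) (r₀ := r₀) (θbar := θbar) (A := A) (δ₀ := δ₀)
            (δ₁ := δ₁) (𝒞 := fun j => 𝒞 1 j) (Kf true j) h₀) - (initAct (N := N) (Mord := Mord) (R := R) (p := pT) (r₀ := r₀) (θbar := θbar) (A := A) (δ₀ := δ₀)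
            (δ₁ := δ₁) (𝒞 := fun j => 𝒞 1 j) (Kf false j) h₀)) (Real.exp (1 / 4) * Real.exp (fieldWt h (L : ℝ) d 0 / (L : ℝ) ^ 0) * A * u₁)) ∧
    (∀ i, ∀ h₀ : HamSpace ℂ d (fieldWt h (L : ℝ) d 0) ((L : ℝ) ^ 0) (L ^ (d * 0)), ‖h₀‖ ≤ ρ →
      activityNormLE (abkmNormParams L N Mord R pT r₀ h θbar A (schedDelta δ₀ δ₁ N) fun j => 𝒞 1 j) 0
        ((initAct (N := N) (Mord := Mord) (R := R) (p := pT) (r₀ := r₀) (θbar := θbar) (A := A) (δ₀ := δ₀)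
            (δ₁ := δ₁) (𝒞 := fun j => 𝒞 1 j) (Kf i true) h₀) - (initAct (N := N) (Mord := Mord) (R := R) (p := pT) (r₀ := r₀) (θbar := θbar) (A := A) (δ₀ := δ₀)
            (δ₁ := δ₁) (𝒞 := fun j => 𝒞 1 j) (Kf i false) h₀)) (Real.exp (1 / 4) * Real.exp (fieldWt h (L : ℝ) d 0 / (L : ℝ) ^ 0) * A * u₂)) ∧
    (∀ h₀ y z : HamSpace ℂ d (fieldWt h (L : ℝ) d 0) ((L : ℝ) ^ 0) (L ^ (d * 0)), ‖h₀‖ ≤ ρ → ‖h₀ + y‖ ≤ ρ → ‖h₀ + z‖ ≤ ρ → ‖h₀ + y + z‖ ≤ ρ →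
      activityNormLE (abkmNormParams L N Mord R pT r₀ h θbar A (schedDelta δ₀ δ₁ N) fun j => 𝒞 1 j) 0
        ((initAct (N := N) (Mord := Mord) (R := R) (p := pT) (r₀ := r₀) (θbar := θbar) (A := A) (δ₀ := δ₀)
            (δ₁ := δ₁) (𝒞 := fun j => 𝒞 1 j) (Kf true true) (h₀ + y + z)) - (initAct (N := N) (Mord := Mord) (R := R) (p := pT) (r₀ := r₀) (θbar := θbar) (A := A) (δ₀ := δ₀)
            (δ₁ := δ₁) (𝒞 := fun j => 𝒞 1 j) (Kf true false) (h₀ + y))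
          - (initAct (N := N) (Mord := Mord) (R := R) (p := pT) (r₀ := r₀) (θbar := θbar) (A := A) (δ₀ := δ₀)
            (δ₁ := δ₁) (𝒞 := fun j => 𝒞 1 j) (Kf false true) (h₀ + z)) + (initAct (N := N) (Mord := Mord) (R := R) (p := pT) (r₀ := r₀) (θbar := θbar) (A := A) (δ₀ := δ₀)
            (δ₁ := δ₁) (𝒞 := fun j => 𝒞 1 j) (Kf false false) h₀))
        (((3 / 2 : ℝ) * (16 * Real.exp (3 / 8)) ^ 2 + 128 * Real.exp (1 / 4)
          + 192 * Real.exp (3 / 8) * (Real.exp (fieldWt h (L : ℝ) d 0 / (L : ℝ) ^ 0) * A)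
          + 6 * (Real.exp (fieldWt h (L : ℝ) d 0 / (L : ℝ) ^ 0) * Real.exp (1 / 4) * A) ^ 2) * (u₁ + ‖y‖) * (u₂ + ‖z‖))) := by
  have hρ16 : ρ ≤ 1 / 16 := hρ64.trans (by norm_num)
  have hE : 0 < Real.exp (fieldWt h (L : ℝ) d 0 / (L : ℝ) ^ 0) := Real.exp_pos _
  have hρ𝒦 : 0 ≤ ρ𝒦 := by
    have h0 := (norm_nonneg _).trans (h𝒦b 0 (Nat.zero_le _) 0)
    exact (mul_nonneg_iff_of_pos_right (Real.exp_pos _)).1 h0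
  have hsm1 : Real.exp (1 / 4) * (ρ𝒦 * Real.exp (fieldWt h (L : ℝ) d 0 / (L : ℝ) ^ 0)) * A ≤ 1 := by
    have h2 : Real.exp (1 / 4) ≤ Real.exp (1 / 4) + 2 * Real.exp (3 / 8) := by
      have := Real.exp_pos (3 / 8 : ℝ); linarith
    have h3 : Real.exp (1 / 4) * (ρ𝒦 * Real.exp (fieldWt h (L : ℝ) d 0 / (L : ℝ) ^ 0)) * A ≤
        (Real.exp (1 / 4) + 2 * Real.exp (3 / 8)) * (ρ𝒦 * Real.exp (fieldWt h (L : ℝ) d 0 / (L : ℝ) ^ 0)) * A :=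
      mul_le_mul_of_nonneg_right (mul_le_mul_of_nonneg_right h2 (mul_nonneg hρ𝒦 hE.le)) hA.le
    exact h3.trans (h𝒦small.trans (by norm_num))
  -- the perturbation sizes are nonnegative-compatible: `ρ ≥ 0` is not needed, but `2ρ`-bounds need the ball
  have hbig : ∀ {a b : ℝ}, 0 ≤ a → a ≤ 2 * ρ → 0 ≤ b → b ≤ 2 * ρ →
      Real.exp (1 / 4) + 16 * Real.exp (3 / 8) * a + 16 * Real.exp (3 / 8) * b + 256 * Real.exp (1 / 4) * a * b
        ≤ Real.exp (1 / 4) + 16 * Real.exp (3 / 8) * (2 * ρ) + 16 * Real.exp (3 / 8) * (2 * ρ)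
          + 256 * Real.exp (1 / 4) * (2 * ρ) * (2 * ρ) := by
    intro a b ha hab hb hbb
    have hρ0 : 0 ≤ ρ := by linarith
    have h1 := Real.exp_pos (3 / 8 : ℝ)
    have h2 := Real.exp_pos (1 / 4 : ℝ)
    gcongr
  have hpert' : ∀ {a b t : ℝ}, 0 ≤ a → a ≤ 2 * ρ → 0 ≤ b → b ≤ 2 * ρ → 0 ≤ t → t ≤ ρ𝒦 + u₁ + u₂ →
      (Real.exp (1 / 4) + 16 * Real.exp (3 / 8) * a + 16 * Real.exp (3 / 8) * b + 256 * Real.exp (1 / 4) * a * b)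
        * (t * Real.exp (fieldWt h (L : ℝ) d 0 / (L : ℝ) ^ 0)) * A ≤ 1 / 2 := by
    intro a b t ha hab hb hbb ht htt
    refine le_trans ?_ hpert
    have h1 : t * Real.exp (fieldWt h (L : ℝ) d 0 / (L : ℝ) ^ 0) ≤ (ρ𝒦 + u₁ + u₂) * Real.exp (fieldWt h (L : ℝ) d 0 / (L : ℝ) ^ 0) := mul_le_mul_of_nonneg_right htt hE.le
    have h0 : 0 ≤ t * Real.exp (fieldWt h (L : ℝ) d 0 / (L : ℝ) ^ 0) := mul_nonneg ht hE.le
    have hf0 : 0 ≤ Real.exp (1 / 4) + 16 * Real.exp (3 / 8) * (2 * ρ) + 16 * Real.exp (3 / 8) * (2 * ρ)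
        + 256 * Real.exp (1 / 4) * (2 * ρ) * (2 * ρ) := by
      have hρ0 : 0 ≤ ρ := by linarith
      positivity
    exact mul_le_mul_of_nonneg_right (mul_le_mul (hbig ha hab hb hbb) h1 h0 hf0) hA.le
  -- the four perturbations
  have hKfd : ∀ i j, ContDiff ℝ r₀ (Kf i j) := by
    intro i j
    cases i <;> cases j
    · rw [hKff]; exact h𝒦
    · rw [hKft]; exact h𝒦.add hV
    · rw [hKtf]; exact h𝒦.add hU
    · rw [hKtt]; exact (h𝒦.add hU).add hV
  have hKfb : ∀ i j, ∀ s, s ≤ r₀ → ∀ z : Fin d → ℝ,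
      ‖iteratedFDeriv ℝ s (Kf i j) z‖ ≤ ρ𝒦 * Real.exp ((∑ i, z i ^ 2) / 4) := by
    intro i j
    cases i <;> cases j
    · rw [hKff]; exact h𝒦b
    · rw [hKft]; exact h𝒦Vb
    · rw [hKtf]; exact h𝒦Ub
    · rw [hKtt]; exact h𝒦UVb
  have hKdi : ∀ j, (fun z => Kf true j z - Kf false j z) = U := by
    intro j
    cases j
    · rw [hKtf, hKff]; funext z; ring
    · rw [hKtt, hKft]; funext z; ring
  have hKdj : ∀ i, (fun z => Kf i true z - Kf i false z) = V := by
    intro i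
    cases i
    · rw [hKft, hKff]; funext z; ring
    · rw [hKtt, hKtf]; funext z; ring
  refine ⟨?_, ?_, ?_, ?_⟩
  · intro i j h₀ h₀' hh₀ hh₀'
    exact activityNormLE_initAct_sub hd2 hLodd hM hp hMord hB hδ₀ hδ₁ hh hh0 hA (hKfd i j) (hKfb i j) h𝒦small h₀ h₀'
      (hh₀.trans hρ16) (hh₀'.trans hρ16)
  · intro j h₀ hh₀
    have hρ0' : 0 ≤ ρ := (norm_nonneg _).trans hh₀
    have hΔ : ∀ s, s ≤ r₀ → ∀ z : Fin d → ℝ,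
        ‖iteratedFDeriv ℝ s (fun z => Kf true j z - Kf false j z) z‖ ≤ u₁ * Real.exp ((∑ i, z i ^ 2) / 4) := by
      rw [hKdi j]; exact hUb
    have hp1 : Real.exp (1 / 4) * ((ρ𝒦 + u₁) * Real.exp (fieldWt h (L : ℝ) d 0 / (L : ℝ) ^ 0)) * A ≤ 1 / 2 := by
      have h := hpert' le_rfl (by linarith) le_rfl (by linarith) (by linarith : 0 ≤ ρ𝒦 + u₁) (by linarith)
      simpa using h
    exact activityNormLE_initAct_sub_pert hd2 hLodd hM hp hMord hB hδ₀ hδ₁ hh hh0 hA (hKfd true j) (hKfd false j)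
      (hKfb true j) (hKfb false j) hΔ hp1 h₀ (hh₀.trans (hρ16.trans (by norm_num)))
  · intro i h₀ hh₀
    have hρ0' : 0 ≤ ρ := (norm_nonneg _).trans hh₀
    have hΔ : ∀ s, s ≤ r₀ → ∀ z : Fin d → ℝ,
        ‖iteratedFDeriv ℝ s (fun z => Kf i true z - Kf i false z) z‖ ≤ u₂ * Real.exp ((∑ i, z i ^ 2) / 4) := by
      rw [hKdj i]; exact hVb
    have hp2 : Real.exp (1 / 4) * ((ρ𝒦 + u₂) * Real.exp (fieldWt h (L : ℝ) d 0 / (L : ℝ) ^ 0)) * A ≤ 1 / 2 := by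
      have h := hpert' le_rfl (by linarith) le_rfl (by linarith) (by linarith : 0 ≤ ρ𝒦 + u₂) (by linarith)
      simpa using h
    exact activityNormLE_initAct_sub_pert hd2 hLodd hM hp hMord hB hδ₀ hδ₁ hh hh0 hA (hKfd i true) (hKfd i false)
      (hKfb i true) (hKfb i false) hΔ hp2 h₀ (hh₀.trans (hρ16.trans (by norm_num)))
  · intro h₀ y z hh₀ hy hz hyz
    have hρ0' : 0 ≤ ρ := (norm_nonneg _).trans hh₀
    have hny : ‖y‖ ≤ 2 * ρ := by
      have e : y = (h₀ + y) - h₀ := by abel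
      rw [e]; exact (norm_sub_le _ _).trans (by linarith)
    have hnz : ‖z‖ ≤ 2 * ρ := by
      have e : z = (h₀ + z) - h₀ := by abel
      rw [e]; exact (norm_sub_le _ _).trans (by linarith)
    have hsm := hpert' (norm_nonneg y) hny (norm_nonneg z) hnz (by linarith : 0 ≤ ρ𝒦 + u₁ + u₂) le_rfl
    rw [hKtt, hKtf, hKft, hKff]
    exact activityNormLE_initAct_jointSecondDiff_bilinear hd2 hLodd hM hp hMord hB hδ₀ hδ₁ hh hh0 hA h𝒦 hU hV h𝒦b
      h𝒦Ub h𝒦Vb h𝒦UVb hUb hVb hsm1 h₀ y z (hh₀.trans hρ64) (hy.trans hρ64) (hz.trans hρ64) (hyz.trans hρ64) hsm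

end Package

end Summit.HubbardSuperconductivity.HubbardSuperconductivity.Theorems.ComplexGFF

end
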